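import Summits.AtomisticToContinuum.BoseEinsteinCondensation.Theses.BECProbeMassFlow

/-!
# Route `BECProbeMassFlow`, support item `StaticFloorCondenses` (stmt-AtomisticToContinuum-12312)

Settles the support (glue) item `stmt-AtomisticToContinuum-12312` of route
`route-AtomisticToContinuum-BECProbeMassFlow`: for each repulsive finite-range `v`,

  `[CloudMomentumAtom body for v] → [RecoilTransfer body for v] → [PeriodicBEC body for v]`,

i.e. the zero-cloud-momentum floor of pinned-scatterer near-minimisers (S1) and the ε-recoil
bridge (S2) combine to constant-mode condensation `≥ N/2` of near-minimisers of the periodic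
`N`-boson energy on the torus of side `(N/ρ)^{1/3}` (the hypothesis of `BoundaryTransferWeak`).

Proof (pure logic plus `Filter`/`ENNReal` bookkeeping, no analysis): take `ε := 1/4` in both
bodies, `ρ₀ := min ρ₀¹ ρ₀²`, `c := 1/2`; for `0 < ρ < ρ₀` intersect the two eventual-`N` sets; at
such `N` the `δ` of S1 is fed to S2 as `δ₁` with floor constant `1 - 1/4` (syntactically S1's
conclusion), which returns `δ₂` with `ofReal ((1 - 1/4 - 1/4) · ↑(N+1)) ≤ condensateOccupation …`
for all `δ₂`-near-minimisers of the `(N+1)`-boson problem on the torus of side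
`sideLength ρ (N+1)`; `1 - 1/4 - 1/4 = 1/2`, and the index shift `N ↦ N + 1` inside `∀ᶠ` is
`Filter.map_add_atTop_eq_nat 1`.

References: [LSSY2005, Ch. 5] (the periodic BEC statement being assembled), [Fournais2020]
(route sources; no mathematical content of either is used here).
-/

namespace Summit.AtomisticToContinuum.BoseEinsteinCondensation.Theorems

open Filter

/-- **Item stmt-AtomisticToContinuum-12312** (`StaticFloorCondenses` of route `BECProbeMassFlow`,
exact route decl): for every repulsive finite-range `v`, the `CloudMomentumAtom` body for `v` and
the `RecoilTransfer` body for `v` imply the periodic-BEC body for `v` — there is `ρ₀ > 0` such that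
for `0 < ρ < ρ₀` some `c > 0` (here `c = 1/2`) bounds below, eventually in `N` and for some slack
`δ > 0`, the constant-mode occupation of every `δ`-near-minimiser of the periodic `N`-boson energy
on the torus of side `sideLength ρ N`: `ENNReal.ofReal (c * N) ≤ condensateOccupation N _ Ψ.ψ`.
Glue: `ε := 1/4` twice, `ρ₀ := min`, intersect the eventual sets, feed S1's `δ` to S2, and shift
`N ↦ N + 1` with `Filter.map_add_atTop_eq_nat`. [folklore] -/
theorem becProbeMassFlow_staticFloorCondenses_proof :
    Summit.AtomisticToContinuum.BoseEinsteinCondensation.Theses.BECProbeMassFlow.StaticFloorCondenses := by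
  unfold Theses.BECProbeMassFlow.StaticFloorCondenses
  intro v _hv h1 h2
  obtain ⟨ρ₁, hρ₁, H1⟩ := h1 (1 / 4) (by norm_num)
  obtain ⟨ρ₂, hρ₂, H2⟩ := h2 (1 / 4) (by norm_num)
  refine ⟨min ρ₁ ρ₂, lt_min hρ₁ hρ₂, fun ρ hρ hρlt => ⟨1 / 2, by norm_num, ?_⟩⟩
  have E1 := H1 ρ hρ (lt_of_lt_of_le hρlt (min_le_left _ _))
  have E2 := H2 ρ hρ (lt_of_lt_of_le hρlt (min_le_right _ _))
  -- index shift `N ↦ N + 1`: `atTop = map (· + 1) atTop` on `ℕ`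
  rw [← Filter.map_add_atTop_eq_nat 1, Filter.eventually_map]
  filter_upwards [E1, E2] with N hN1 hN2
  obtain ⟨δ₁, hδ₁, hfloor⟩ := hN1
  obtain ⟨δ₂, hδ₂, hocc⟩ := hN2 (1 - 1 / 4) δ₁ hδ₁ hfloor
  refine ⟨δ₂, hδ₂, fun Ω hΩ => ?_⟩
  have h := hocc Ω hΩ
  have h12 : ((1 : ℝ) - 1 / 4 - 1 / 4) = 1 / 2 := by norm_num
  rw [h12] at h
  exact h

end Summit.AtomisticToContinuum.BoseEinsteinCondensation.Theorems
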